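import Mathlib.MeasureTheory.Integral.Lebesgue.Markov
import Mathlib.Topology.Order.Monotone
import Literature.Probability.Distributions.AntitoneKernelVersion
import Literature.Probability.Distributions.LintegralDeterminingClass
import HarnessLib

/-!
# Everywhere-antitone versions of almost-surely antitone locally integrable kernel families

Topic `Literature/Probability/Distributions`; sequel of `AntitoneKernelVersion.lean` (the version
construction on a countable cutoff set) and `LintegralDeterminingClass.lean` (a countable class
of test functions determining `≤` among locally finite measures), written for clause (ADM)(1)–(2)
of the admissibility of the Garban–Pete–Schramm pivotal kernels of lattice models (route
`Summits/CriticalPhenomena/CardyFormulaZ2/Theses/CardyMeckeFlip`, crux `FlipErgodicityZ2`, stub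
"the pivotal kernel of a bond-`ℤ²` sublimit exists and is admissible"), but model-free.

**Main result** (`exists_antitone_version_of_ae_antitone`).  Let `μ` be a measure on `X`, `α`
a proper pseudo-metric Borel space, and `N : ℝ → X → Measure α` a family of kernels which, at
every cutoff `ε > 0`, is measurable, has locally `μ`-integrable masses
(`∫⁻ S, N ε S K ∂μ < ⊤` for compact `K`), and is antitone ALMOST SURELY for each pair of cutoffs
(`N ε S ≤ N ε' S` a.e., `0 < ε' ≤ ε`).  Then there is `M : ℝ → X → Measure α` with every `M ε`
measurable, `ε ↦ M ε S` antitone on all of `ℝ` for EVERY `S`, and `M ε = N ε` almost surely at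
EVERY cutoff `ε > 0`.

Proof.  Countable cutoff set `D` = positive rationals ∪ the (countably many) discontinuity
points of the antitone means `ε ↦ ∫⁻∫⁻ φ d(N ε S) dμ`, `φ` in the countable determining class
`Φ`; measurable conull set `X₀` on which all `N d`, `d ∈ D`, are finite on compacts and antitone
along `D` (determining class); `M ε S := ⨆_{d ∈ D, ε ≤ d} N d S` on `X₀` (the version lemma).
At `ε ∉ D`: `M ε ≤ N ε` a.e., and the means agree by monotone convergence along the directed
supremum (`lintegral_iSup_measure_of_directed`) and continuity of the means at `ε`; equal finite
integrals of a.e.-ordered functions force a.e. equality, and the determining class upgrades the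
countably many equalities of integrals to equality of measures.

Also: `lintegral_iSup_measure_of_directed` (the integral against a countable directed supremum
of measures is the supremum of the integrals), `iSup_eq_of_antitone_of_continuousAt`.

No named fact, no new definition; Mathlib only.

## References

* O. Kallenberg, *Random Measures, Theory and Applications* (2017), §1.2, Lemma 1.14, §2.1
  (versions / regularisation of random measures and kernels).
-/

noncomputable section

open Set Filter Metric
open _root_.MeasureTheory _root_.Topology
open scoped ENNReal

namespace Literature.Probability.Distributions

/-! ### Integration against a directed supremum of measures -/

section DirectedSup

variable {α ι : Type*} [MeasurableSpace α] [Countable ι] {ν : ι → Measure α}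

/-- **Monotone convergence for a countable directed supremum of measures**: for measurable
`f ≥ 0`, `∫⁻ f d(⨆ i, ν i) = ⨆ i, ∫⁻ f dν i` (simple functions: the supremum is setwise,
`iSup_measure_apply_of_directed`, and finite sums commute with directed suprema). [folklore] -/
theorem lintegral_iSup_measure_of_directed (hν : Directed (· ≤ ·) ν) {f : α → ℝ≥0∞}
    (hf : Measurable f) : ∫⁻ x, f x ∂(⨆ i, ν i) = ⨆ i, ∫⁻ x, f x ∂(ν i) := by
  have hsimple : ∀ s : SimpleFunc α ℝ≥0∞, s.lintegral (⨆ i, ν i) = ⨆ i, s.lintegral (ν i) := by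
    intro s
    simp only [SimpleFunc.lintegral]
    simp_rw [iSup_measure_apply_of_directed hν, ENNReal.mul_iSup]
    refine ENNReal.finsetSum_iSup fun i j => ?_
    obtain ⟨k, hik, hjk⟩ := hν i j
    exact ⟨k, fun c => ⟨mul_le_mul' le_rfl (Measure.le_iff'.1 hik _),
      mul_le_mul' le_rfl (Measure.le_iff'.1 hjk _)⟩⟩
  rw [lintegral_eq_iSup_eapprox_lintegral hf]
  simp_rw [hsimple]
  rw [iSup_comm]
  exact iSup_congr fun i => (lintegral_eq_iSup_eapprox_lintegral hf).symm

end DirectedSup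

/-! ### Suprema of antitone functions at continuity points -/

/-- For an antitone `G : ℝ → ℝ≥0∞` continuous at `ε`, the supremum of `G` over a set of points
`≥ ε` that accumulate at `ε` from the right is `G ε`. [folklore] -/
theorem iSup_eq_of_antitone_of_continuousAt {G : ℝ → ℝ≥0∞} (hG : Antitone G) {ε : ℝ}
    (hc : ContinuousAt G ε) {D : Set ℝ} (hD : ∀ η : ℝ, 0 < η → ∃ d ∈ D, ε ≤ d ∧ d < ε + η) :
    (⨆ d : {d : ℝ // d ∈ D ∧ ε ≤ d}, G d) = G ε := by
  refine le_antisymm (iSup_le fun d => hG d.2.2) (le_of_forall_lt fun c hc' => ?_)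
  have hev : ∀ᶠ x in 𝓝 ε, c < G x := hc.eventually (lt_mem_nhds hc')
  obtain ⟨η, hη, hball⟩ := Metric.eventually_nhds_iff.1 hev
  obtain ⟨d, hdD, hεd, hdη⟩ := hD η hη
  have hd : c < G d := hball (by rw [Real.dist_eq, abs_of_nonneg (by linarith)]; linarith)
  exact hd.trans_le (le_iSup (fun d : {d : ℝ // d ∈ D ∧ ε ≤ d} => G d) ⟨d, hdD, hεd⟩)

/-- A set containing all rationals above `ε` accumulates at `ε` from the right. [folklore] -/
theorem exists_mem_of_rat_subset {D : Set ℝ} {ε : ℝ}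
    (hD : ∀ q : ℚ, ε < q → (q : ℝ) ∈ D) (η : ℝ) (hη : 0 < η) :
    ∃ d ∈ D, ε ≤ d ∧ d < ε + η := by
  obtain ⟨q, hq1, hq2⟩ := exists_rat_btwn (show ε < ε + η by linarith)
  exact ⟨q, hD q hq1, hq1.le, hq2⟩

/-! ### The version theorem -/

section Helpers

variable {α : Type*} [PseudoMetricSpace α] [MeasurableSpace α]

/-- A measure dominated by a measure finite on compacts is finite on compacts. [folklore] -/
theorem isFiniteMeasureOnCompacts_of_le {m m' : Measure α} [IsFiniteMeasureOnCompacts m]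
    (h : m' ≤ m) : IsFiniteMeasureOnCompacts m' :=
  ⟨fun K hK => (Measure.le_iff'.1 h K).trans_lt hK.measure_lt_top⟩

/-- In a proper space with a base point, a measure finite on all closed balls around it is
finite on compacts. [folklore] -/
theorem isFiniteMeasureOnCompacts_of_closedBall (x₀ : α) {m : Measure α}
    (h : ∀ n : ℕ, m (closedBall x₀ n) < ⊤) : IsFiniteMeasureOnCompacts m := by
  refine ⟨fun K hK => ?_⟩
  obtain ⟨r, hr⟩ := hK.isBounded.subset_closedBall x₀
  obtain ⟨n, hn⟩ := exists_nat_ge r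
  exact (measure_mono (hr.trans (closedBall_subset_closedBall hn))).trans_lt (h n)

/-- The integral of a `[0,1]`-valued function is at most the mass of its topological support.
[folklore] -/
theorem lintegral_ofReal_le_measure_tsupport [BorelSpace α] (m : Measure α) {φ : α → ℝ}
    (hφ01 : ∀ x, φ x ∈ Icc (0 : ℝ) 1) :
    ∫⁻ x, ENNReal.ofReal (φ x) ∂m ≤ m (tsupport φ) := by
  calc ∫⁻ x, ENNReal.ofReal (φ x) ∂m ≤ ∫⁻ x, (tsupport φ).indicator 1 x ∂m := by
        refine lintegral_mono fun x => ?_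
        by_cases hx : x ∈ tsupport φ
        · rw [indicator_of_mem hx, Pi.one_apply, ← ENNReal.ofReal_one]
          exact ENNReal.ofReal_le_ofReal (hφ01 x).2
        · rw [indicator_of_notMem hx, image_eq_zero_of_notMem_tsupport hx, ENNReal.ofReal_zero]
    _ = m (tsupport φ) := lintegral_indicator_one (isClosed_tsupport φ).measurableSet

end Helpers

section Version

variable {X : Type*} [MeasurableSpace X] {α : Type*} [PseudoMetricSpace α] [ProperSpace α]
  [MeasurableSpace α] [BorelSpace α]

/-- **Everywhere-antitone measurable versions of almost-surely antitone, locally integrable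
kernel families.**  Let `N : ℝ → X → Measure α` (`α` a proper pseudo-metric Borel space) be,
at every cutoff `ε > 0`, measurable with locally `μ`-integrable masses, and antitone almost
surely for each pair of cutoffs `0 < ε' ≤ ε`.  Then there is `M : ℝ → X → Measure α` with every
`M ε` measurable, `ε ↦ M ε S` antitone on `ℝ` for every `S`, and `M ε = N ε` a.e. at every
`ε > 0`. [folklore] -/
theorem exists_antitone_version_of_ae_antitone (μ : Measure X) (N : ℝ → X → Measure α)
    (hN : ∀ ε : ℝ, 0 < ε → Measurable (N ε))
    (hfin : ∀ ε : ℝ, 0 < ε → ∀ K : Set α, IsCompact K → ∫⁻ S, N ε S K ∂μ < ⊤)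
    (hanti : ∀ ε ε' : ℝ, 0 < ε' → ε' ≤ ε → ∀ᵐ S ∂μ, N ε S ≤ N ε' S) :
    ∃ M : ℝ → X → Measure α,
      (∀ ε, Measurable (M ε)) ∧ (∀ ε ε' : ℝ, ε' ≤ ε → ∀ S, M ε S ≤ M ε' S) ∧
        ∀ ε : ℝ, 0 < ε → ∀ᵐ S ∂μ, M ε S = N ε S := by
  classical
  rcases isEmpty_or_nonempty α with hα | ⟨⟨x₀⟩⟩
  · refine ⟨fun _ _ => 0, fun _ => measurable_const, fun _ _ _ _ => le_rfl, fun ε hε => ?_⟩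
    exact ae_of_all _ fun S => (Measure.eq_zero_of_isEmpty (N ε S)).symm
  -- the determining class and the integrals of its members
  obtain ⟨Φ, hΦc, hΦ, hdet⟩ := exists_countable_determining_le α
  have hΦm : ∀ φ ∈ Φ, Measurable fun x => ENNReal.ofReal (φ x) := fun φ hφ =>
    (hΦ φ hφ).1.measurable.ennreal_ofReal
  have hIm : ∀ φ ∈ Φ, ∀ ε : ℝ, 0 < ε →
      Measurable fun S => ∫⁻ x, ENNReal.ofReal (φ x) ∂(N ε S) := fun φ hφ ε hε =>
    (Measure.measurable_lintegral (hΦm φ hφ)).comp (hN ε hε)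
  -- the means and their (countably many) discontinuity cutoffs
  set G : (α → ℝ) → ℝ → ℝ≥0∞ := fun φ ε =>
    if 0 < ε then ∫⁻ S, ∫⁻ x, ENNReal.ofReal (φ x) ∂(N ε S) ∂μ else ⊤ with hGdef
  have hGpos : ∀ φ (ε : ℝ), 0 < ε → G φ ε = ∫⁻ S, ∫⁻ x, ENNReal.ofReal (φ x) ∂(N ε S) ∂μ :=
    fun φ ε hε => if_pos hε
  have hGanti : ∀ φ, Antitone (G φ) := by
    intro φ ε' ε hle
    by_cases hε' : 0 < ε'
    · have hε : 0 < ε := hε'.trans_le hle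
      rw [hGpos φ ε hε, hGpos φ ε' hε']
      refine lintegral_mono_ae ((hanti ε ε' hε' hle).mono fun S hS => ?_)
      exact lintegral_mono' hS le_rfl
    · rw [hGdef]
      simp only [hε', if_false]
      exact le_top
  set Disc : Set ℝ := ⋃ φ ∈ Φ, {ε | ¬ ContinuousAt (G φ) ε} with hDisc
  have hDiscc : Disc.Countable := hΦc.biUnion fun φ _ => (hGanti φ).countable_not_continuousAt
  set D : Set ℝ := (range (fun q : ℚ => (q : ℝ)) ∩ Ioi 0) ∪ (Disc ∩ Ioi 0) with hDdef
  have hDc : D.Countable := ((countable_range _).mono inter_subset_left).union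
    (hDiscc.mono inter_subset_left)
  have hDpos : ∀ d ∈ D, 0 < d := by
    rintro d (⟨-, hd⟩ | ⟨-, hd⟩) <;> exact hd
  have hDrat : ∀ ε : ℝ, 0 < ε → ∀ q : ℚ, ε < q → (q : ℝ) ∈ D := fun ε hε q hq =>
    Or.inl ⟨mem_range_self q, hε.trans hq⟩
  -- the good set `X₀`
  set X₀ : Set X := (⋂ d ∈ D, ⋂ n : ℕ, {S | N d S (closedBall x₀ n) < ⊤}) ∩
    ⋂ d ∈ D, ⋂ d' ∈ D, ⋂ (_ : d ≤ d'), ⋂ φ ∈ Φ,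
      {S | ∫⁻ x, ENNReal.ofReal (φ x) ∂(N d' S) ≤ ∫⁻ x, ENNReal.ofReal (φ x) ∂(N d S)}
    with hX₀def
  have hX₀mem : ∀ S, S ∈ X₀ ↔ (∀ d ∈ D, ∀ n : ℕ, N d S (closedBall x₀ n) < ⊤) ∧
      (∀ d ∈ D, ∀ d' ∈ D, d ≤ d' → ∀ φ ∈ Φ,
        ∫⁻ x, ENNReal.ofReal (φ x) ∂(N d' S) ≤ ∫⁻ x, ENNReal.ofReal (φ x) ∂(N d S)) := by
    intro S
    simp only [hX₀def, mem_inter_iff, mem_iInter, mem_setOf_eq]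
  have hX₀m : MeasurableSet X₀ := by
    refine MeasurableSet.inter ?_ ?_
    · refine MeasurableSet.biInter hDc fun d hd => MeasurableSet.iInter fun n => ?_
      exact measurableSet_lt ((Measure.measurable_coe measurableSet_closedBall).comp
        (hN d (hDpos d hd))) measurable_const
    · refine MeasurableSet.biInter hDc fun d hd => MeasurableSet.biInter hDc fun d' hd' => ?_
      refine MeasurableSet.iInter fun _ => MeasurableSet.biInter hΦc fun φ hφ => ?_
      exact measurableSet_le (hIm φ hφ d' (hDpos d' hd')) (hIm φ hφ d (hDpos d hd))
  have hX₀ae : ∀ᵐ S ∂μ, S ∈ X₀ := by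
    have h1 : ∀ᵐ S ∂μ, ∀ d ∈ D, ∀ n : ℕ, N d S (closedBall x₀ n) < ⊤ := by
      refine (ae_ball_iff hDc).2 fun d hd => ae_all_iff.2 fun n => ?_
      exact ae_lt_top ((Measure.measurable_coe measurableSet_closedBall).comp
        (hN d (hDpos d hd))) (hfin d (hDpos d hd) _ (isCompact_closedBall _ _)).ne
    have h2 : ∀ᵐ S ∂μ, ∀ d ∈ D, ∀ d' ∈ D, d ≤ d' → ∀ φ ∈ Φ,
        ∫⁻ x, ENNReal.ofReal (φ x) ∂(N d' S) ≤ ∫⁻ x, ENNReal.ofReal (φ x) ∂(N d S) := by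
      refine (ae_ball_iff hDc).2 fun d hd => (ae_ball_iff hDc).2 fun d' hd' => ?_
      by_cases hdd' : d ≤ d'
      · filter_upwards [hanti d' d (hDpos d hd) hdd'] with S hS _ φ _
        exact lintegral_mono' hS le_rfl
      · exact ae_of_all _ fun S h => (hdd' h).elim
    filter_upwards [h1, h2] with S hS1 hS2
    exact (hX₀mem S).2 ⟨hS1, hS2⟩
  -- on `X₀`, the kernels `N d`, `d ∈ D`, are finite on compacts and antitone along `D`
  have hX₀fin : ∀ S ∈ X₀, ∀ d ∈ D, IsFiniteMeasureOnCompacts (N d S) := fun S hS d hd =>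
    isFiniteMeasureOnCompacts_of_closedBall x₀ (((hX₀mem S).1 hS).1 d hd)
  have hX₀anti : ∀ S ∈ X₀, ∀ d ∈ D, ∀ d' ∈ D, d ≤ d' → N d' S ≤ N d S := by
    intro S hS d hd d' hd' hdd'
    haveI := hX₀fin S hS d hd
    exact hdet (N d S) (N d' S) inferInstance fun φ hφ =>
      ((hX₀mem S).1 hS).2 d hd d' hd' hdd' φ hφ
  -- the version on `D`
  obtain ⟨M, hMm, hMono, hMD, hMoff, hMsup⟩ :=
    exists_antitone_version hDc N (fun d hd => hN d (hDpos d hd)) hX₀m hX₀anti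
  refine ⟨M, hMm, hMono, fun ε hε => ?_⟩
  -- `M ε = N ε` a.e. at every `ε > 0`
  by_cases hεD : ε ∈ D
  · exact hX₀ae.mono fun S hS => hMD ε hεD S hS
  -- `ε ∉ D`: continuity point of all the means
  have hcont : ∀ φ ∈ Φ, ContinuousAt (G φ) ε := by
    intro φ hφ
    by_contra h
    exact hεD (Or.inr ⟨mem_iUnion₂.2 ⟨φ, hφ, h⟩, hε⟩)
  -- the truncated kernels and the directed supremum realising `M ε`
  set N' : ℝ → X → Measure α := fun d S => if S ∈ X₀ then N d S else 0 with hN'def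
  haveI hcount : Countable {d : ℝ // d ∈ D ∧ ε ≤ d} :=
    (hDc.mono fun d (hd : d ∈ D ∧ ε ≤ d) => hd.1).to_subtype
  have hdir : ∀ S, Directed (· ≤ ·) fun d : {d : ℝ // d ∈ D ∧ ε ≤ d} => N' d S := by
    intro S d₁ d₂
    have hmin : min d₁.1 d₂.1 ∈ D := by
      rcases min_choice d₁.1 d₂.1 with h | h <;> rw [h]
      exacts [d₁.2.1, d₂.2.1]
    refine ⟨⟨min d₁.1 d₂.1, hmin, le_min d₁.2.2 d₂.2.2⟩, ?_, ?_⟩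
    · by_cases hS : S ∈ X₀
      · simp only [hN'def, hS, if_true]
        exact hX₀anti S hS _ hmin _ d₁.2.1 (min_le_left _ _)
      · simp only [hN'def, hS, if_false, le_refl]
    · by_cases hS : S ∈ X₀
      · simp only [hN'def, hS, if_true]
        exact hX₀anti S hS _ hmin _ d₂.2.1 (min_le_right _ _)
      · simp only [hN'def, hS, if_false, le_refl]
  have hMeq : ∀ S, M ε S = ⨆ d : {d : ℝ // d ∈ D ∧ ε ≤ d}, N' d S := by
    intro S
    by_cases hS : S ∈ X₀
    · refine Measure.ext fun s _ => ?_
      rw [hMsup S hS ε s, iSup_measure_apply_of_directed (hdir S) s]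
      simp only [hN'def, hS, if_true]
    · rw [hMoff S hS ε]
      refine le_antisymm bot_le (iSup_le fun d => ?_)
      simp only [hN'def, hS, if_false, le_refl]
  -- (i) `M ε S ≤ N ε S` a.e.
  have hle : ∀ᵐ S ∂μ, M ε S ≤ N ε S := by
    have h : ∀ᵐ S ∂μ, ∀ d ∈ D, ε ≤ d → N d S ≤ N ε S := by
      refine (ae_ball_iff hDc).2 fun d hd => ?_
      by_cases hεd : ε ≤ d
      · filter_upwards [hanti d ε hε hεd] with S hS _ using hS
      · exact ae_of_all _ fun S h => (hεd h).elim
    filter_upwards [h] with S hS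
    rw [hMeq S]
    refine iSup_le fun d => ?_
    by_cases hSX : S ∈ X₀
    · simp only [hN'def, hSX, if_true]
      exact hS d.1 d.2.1 d.2.2
    · simp only [hN'def, hSX, if_false]
      exact bot_le
  -- (ii) equality of the means of every `φ ∈ Φ`, hence a.e. equality of the integrals
  have hint : ∀ φ ∈ Φ, ∀ᵐ S ∂μ,
      ∫⁻ x, ENNReal.ofReal (φ x) ∂(M ε S) = ∫⁻ x, ENNReal.ofReal (φ x) ∂(N ε S) := by
    intro φ hφ
    obtain ⟨hφc', hφs, hφ01⟩ := hΦ φ hφ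
    set A : X → ℝ≥0∞ := fun S => ∫⁻ x, ENNReal.ofReal (φ x) ∂(M ε S) with hA
    set B : X → ℝ≥0∞ := fun S => ∫⁻ x, ENNReal.ofReal (φ x) ∂(N ε S) with hB
    have hAm : Measurable A := (Measure.measurable_lintegral (hΦm φ hφ)).comp (hMm ε)
    have hBm : Measurable B := hIm φ hφ ε hε
    have hAB : A ≤ᵐ[μ] B := hle.mono fun S hS => lintegral_mono' hS le_rfl
    -- `∫ B < ⊤`
    have hBfin : ∫⁻ S, B S ∂μ < ⊤ := by
      refine lt_of_le_of_lt (lintegral_mono fun S => ?_) (hfin ε hε _ hφs)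
      exact lintegral_ofReal_le_measure_tsupport _ hφ01
    -- `∫ A = sup over `d` of the means = G φ ε = ∫ B`
    have hN'm : ∀ d : {d : ℝ // d ∈ D ∧ ε ≤ d}, Measurable (N' d) := fun d =>
      Measurable.ite hX₀m (hN d (hDpos d d.2.1)) measurable_const
    have hAsup : ∀ S, A S = ⨆ d : {d : ℝ // d ∈ D ∧ ε ≤ d}, ∫⁻ x, ENNReal.ofReal (φ x) ∂(N' d S) :=
      fun S => by rw [hA]; simp only; rw [hMeq S, lintegral_iSup_measure_of_directed (hdir S) (hΦm φ hφ)]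
    have hdir' : Directed (· ≤ ·)
        fun (d : {d : ℝ // d ∈ D ∧ ε ≤ d}) (S : X) => ∫⁻ x, ENNReal.ofReal (φ x) ∂(N' d S) := by
      intro d₁ d₂
      obtain ⟨d₃, h₃⟩ : ∃ d₃ : {d : ℝ // d ∈ D ∧ ε ≤ d}, ∀ S, N' d₁ S ≤ N' d₃ S ∧ N' d₂ S ≤ N' d₃ S := by
        have hmin : min d₁.1 d₂.1 ∈ D := by
          rcases min_choice d₁.1 d₂.1 with h | h <;> rw [h]
          exacts [d₁.2.1, d₂.2.1]
        refine ⟨⟨min d₁.1 d₂.1, hmin, le_min d₁.2.2 d₂.2.2⟩, fun S => ?_⟩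
        by_cases hS : S ∈ X₀
        · simp only [hN'def, hS, if_true]
          exact ⟨hX₀anti S hS _ hmin _ d₁.2.1 (min_le_left _ _),
            hX₀anti S hS _ hmin _ d₂.2.1 (min_le_right _ _)⟩
        · simp only [hN'def, hS, if_false, le_refl, and_self]
      exact ⟨d₃, fun S => lintegral_mono' (h₃ S).1 le_rfl, fun S => lintegral_mono' (h₃ S).2 le_rfl⟩
    have hmeans : ∀ d : {d : ℝ // d ∈ D ∧ ε ≤ d},
        ∫⁻ S, ∫⁻ x, ENNReal.ofReal (φ x) ∂(N' d S) ∂μ = G φ d := by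
      intro d
      rw [hGpos φ d (hDpos d d.2.1)]
      refine lintegral_congr_ae (hX₀ae.mono fun S hS => ?_)
      simp only [hN'def, hS, if_true]
    have hAint : ∫⁻ S, A S ∂μ = G φ ε := by
      calc ∫⁻ S, A S ∂μ
          = ∫⁻ S, ⨆ d : {d : ℝ // d ∈ D ∧ ε ≤ d}, ∫⁻ x, ENNReal.ofReal (φ x) ∂(N' d S) ∂μ :=
            lintegral_congr fun S => hAsup S
        _ = ⨆ d : {d : ℝ // d ∈ D ∧ ε ≤ d}, ∫⁻ S, ∫⁻ x, ENNReal.ofReal (φ x) ∂(N' d S) ∂μ :=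
            lintegral_iSup_directed_of_measurable
              (fun d => (Measure.measurable_lintegral (hΦm φ hφ)).comp (hN'm d)) hdir'
        _ = ⨆ d : {d : ℝ // d ∈ D ∧ ε ≤ d}, G φ d := iSup_congr hmeans
        _ = G φ ε := iSup_eq_of_antitone_of_continuousAt (hGanti φ) (hcont φ hφ)
            (exists_mem_of_rat_subset (hDrat ε hε))
    have hBint : ∫⁻ S, B S ∂μ = G φ ε := (hGpos φ ε hε).symm
    have hAfin : ∫⁻ S, A S ∂μ ≠ ⊤ := by rw [hAint, ← hBint]; exact hBfin.ne
    exact ae_eq_of_ae_le_of_lintegral_le hAB hAfin hBm.aemeasurable (by rw [hAint, hBint])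
  -- (iii) the determining class: `N ε S ≤ M ε S` a.e.
  have hNfin : ∀ᵐ S ∂μ, IsFiniteMeasureOnCompacts (N ε S) := by
    have h1 : ∀ᵐ S ∂μ, ∀ n : ℕ, N ε S (closedBall x₀ n) < ⊤ := ae_all_iff.2 fun n =>
      ae_lt_top ((Measure.measurable_coe measurableSet_closedBall).comp (hN ε hε))
        (hfin ε hε _ (isCompact_closedBall _ _)).ne
    exact h1.mono fun S hS => isFiniteMeasureOnCompacts_of_closedBall x₀ hS
  filter_upwards [hle, (ae_ball_iff hΦc).2 hint, hNfin] with S hS hSint hSfin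
  haveI := hSfin
  haveI : IsFiniteMeasureOnCompacts (M ε S) := isFiniteMeasureOnCompacts_of_le hS
  exact le_antisymm hS (hdet (M ε S) (N ε S) inferInstance fun φ hφ => (hSint φ hφ).ge)

end Version

end Literature.Probability.Distributions

end
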